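import Summits.BirchSwinnertonDyer.Rank1Residual.X11b.LevelLiftingFromFiniteness
import Literature.NumberTheory.GaloisRepresentations.ContinuousH1ResCocycle
import HarnessLib

/-!
# Crux `PrintCf2.SplitBadTwoRankOneOfFacts` (stmt-BirchSwinnertonDyer-20368), road α v10.3, S3c residual (R-TOP) = brick B17, towards (LS):
# the replacement for «`E[p^∞]^{Γ_K} = 0`» in X11b's Poitou–Tate obstruction argument — a class `H¹(π) z` in the kernel of `H¹(ι_{K₀})` that is
# locally ZERO at one place `v` with `p^{K₀} · E[p^∞]^{Γ_{K_v}} = 0` vanishes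

Cell `bsd-print-cf2`, EXTRA WIDTH seat `bsd-line-cf2-p1-w4` g9 (prover-bsd-line-cf2-p1-w4-g9-0); `--supports stmt-BirchSwinnertonDyer-20368`
(helper, Theses-free). HONEST FRAMING: nothing here closes the crux or a registered stub; BSD is not proved by any of this; no summit statement
is proved by this seat. No definition, no named fact, no `sorry`.

WHY (TURNKEY-20368-LS-w4g9.md §2(c)). X11b's `sum_localTatePairingZMod_liftFamily_eq_zero` kills `H¹(π) ỹ` (`π` = multiplication by `p^e`,
`E[p^{K₀+e}] → E[p^{K₀}]`) by the INJECTIVITY of `H¹(ι_{K₀}) : H¹(K, E[p^{K₀}]) → H¹(K, E[p^∞])`, i.e. by «`E[p^∞]^{Γ_K} = 0`» — false for the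
members `cm7^{(d)}` (`W[2] ⊂ W(K)`). For `W*`-families the dual Selmer structure is STRICT at the relaxed place `v` of `𝔖` (and the `W*′`-component of
`ỹ` is what must die), so `ỹ_v = 0`; this file proves the level-theoretic lemma that then replaces injectivity:
**`map_levelMul_eq_zero_of_localization_eq_zero`** — if `H¹(ι_{K₀})(H¹(π) z) = 0`, `loc_v z = 0`, and `p^{K₀}` kills `E[p^∞]^{Γ_{K_v}}` (finite local
torsion: choose `K₀` large), then `H¹(π) z = 0`. Mechanism: the kernel of `H¹(ι_{K₀})` consists of connecting classes `δ(Q)` (`p^{K₀} Q ∈ E[p^∞]^{Γ_K}`,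
X11b `Levels.map_primaryInclusion_eq_zero_iff` — no injectivity), connecting classes LOCALISE to connecting classes (`res_connectingClass`), a local
connecting class vanishes iff `p^{K₀} Q = p^{K₀} Q₀` with `Q₀` `Γ_{K_v}`-fixed (`Levels.connectingClass_eq_zero_iff`), whence `p^{K₀} Q = 0` and `δ(Q) = 0`.
presearch: Greenberg LNM 1716 §4 remark after Prop. 4.13 (relax at an auxiliary place where the local torsion is small); JSW17 Prop. 3.3.2; no new
fact. beyond-print theorem: no.

References: [GreenbergLNM1716] §4 pp. 122–125, §5 proof of Prop. 5.8; [JetchevSkinnerWan2017] Prop. 3.3.2; [SerreGaloisCohomology1997] I §2.4.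
-/

noncomputable section

open scoped Classical

set_option linter.dupNamespace false
set_option autoImplicit false

open CategoryTheory Field NumberField IsDedekindDomain
open Literature.NumberTheory.EllipticCurves
open Literature.NumberTheory.GaloisRepresentations
open Literature.NumberTheory.GaloisRepresentations.DiscreteGaloisModule
open Literature.NumberTheory.GaloisCohomology
open scoped ContRepresentation
open Summit.BirchSwinnertonDyer.Rank1Residual.X11b

universe u

namespace Summit.BirchSwinnertonDyer.BirchSwinnertonDyer.Theorems.PrintCf2.LevelEigen

/-! ## §1. Connecting classes localise to connecting classes -/

section Connecting

variable {F : Type u} [Field F] {A B : Type u} [AddCommGroup A] [TopologicalSpace A]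
  [DiscreteTopology A] [AddCommGroup B] [TopologicalSpace B] [DiscreteTopology B]
  {ρA : DiscreteGaloisModule F A} {ρB : DiscreteGaloisModule F B}
  {i : ρA.toContRepresentation →ⁱL ρB.toContRepresentation} {n : ℕ}
  {hrange : ∀ b : B, n • b = 0 → ∃ a : A, i a = b}

/-- **`res_{K→E} δ_K(b) = δ_E(b)`**: the connecting class of `0 → A → B →[n] B → 0` restricts to the connecting class over any `F`-field `E`
(both are the class of `σ ↦ i⁻¹(σ b − b)`, `i` injective). [cite: SerreGaloisCohomology1997, I §2.4] [cite: GreenbergLNM1716, §5 proof of Prop. 5.8] -/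
theorem res_connectingClass (E : Type u) [Field E] [Algebra F E] (hinj : Function.Injective i)
    {hrangeE : ∀ b : B, n • b = 0 → ∃ a : A, (i.restrictField E) a = b} (hinjE : Function.Injective (i.restrictField E))
    (b : B) (hb : ∀ σ : absoluteGaloisGroup F, ρB σ (n • b) = n • b) :
    galoisCohomology.res ρA E 1 (Levels.connectingClass i n hrange hinj b hb) =
      Levels.connectingClass (i.restrictField E) n hrangeE hinjE b (fun σ ↦ hb (absGaloisRestrict F E σ)) := by
  rw [Levels.connectingClass, Levels.connectingClass, galoisCohomology.res_oneCocycleClass]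
  congr 1

end Connecting

/-! ## §2. A kernel class of `H¹(ι_{K₀})` that is locally zero at a place with small local torsion vanishes -/

section Kernel

variable {K : Type} [Field K] [NumberField K] (W : WeierstrassCurve K) (p : ℕ) (K₀ e : ℕ)

/-- **`H¹(ι_{K₀})(H¹(π) z) = 0 ∧ loc_v z = 0 ∧ p^{K₀} · E[p^∞]^{Γ_{K_v}} = 0 ⟹ H¹(π) z = 0`** (`π : E[p^{K₀+e}] → E[p^{K₀}]` multiplication by `p^e`,
`ι_{K₀} : E[p^{K₀}] ↪ E[p^∞]`, `v` a finite place): `H¹(π) z = δ(Q)` with `p^{K₀} Q ∈ E[p^∞]^{Γ_K}` (kernel of `H¹(ι_{K₀})`, no injectivity needed);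
localising, `δ_{K_v}(Q) = loc_v (H¹(π) z) = H¹(π) (loc_v z) = 0`, so `p^{K₀} Q = p^{K₀} Q₀` with `Q₀ ∈ E[p^∞]^{Γ_{K_v}}`, hence `= 0`, hence `δ(Q) = 0`.
The substitute for «`E[p^∞]^{Γ_K} = 0`» in JSW17 Prop. 3.3.2 when the dual Selmer structure is strict at `v`.
[cite: GreenbergLNM1716, §4 remark after Prop. 4.13 (pp. 122–125)] [cite: JetchevSkinnerWan2017, Prop. 3.3.2 (arXiv:1512.06894 p. 11)] -/
theorem map_levelMul_eq_zero_of_localization_eq_zero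
    (z : galoisCohomology (W.torsionGaloisModule ((p ^ (K₀ + e) : ℕ) : ℤ)) 1) (v : HeightOneSpectrum (𝓞 K))
    (ha : galoisCohomology.map (Levels.primaryInclusion W p K₀) 1 (galoisCohomology.map (Levels.levelMul W p K₀ e) 1 z) = 0)
    (hb : galoisCohomology.localization (W.torsionGaloisModule ((p ^ (K₀ + e) : ℕ) : ℤ)) (Sum.inr v) 1 z = 0)
    (hc : ∀ Q : W.geomPrimaryTorsion p,
      (∀ σ : absoluteGaloisGroup (v.adicCompletion K),
        GaloisRep.restrictField (v.adicCompletion K) (LocBridge.primaryGaloisModule W p) σ Q = Q) → p ^ K₀ • Q = 0) :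
    galoisCohomology.map (Levels.levelMul W p K₀ e) 1 z = 0 := by
  obtain ⟨Q, hQ, hz⟩ := (Levels.map_primaryInclusion_eq_zero_iff W p K₀ _).mp ha
  rw [hz]
  -- localise the connecting class
  have hloc : galoisCohomology.localization (W.torsionGaloisModule ((p ^ K₀ : ℕ) : ℤ)) (Sum.inr v) 1
      (galoisCohomology.map (Levels.levelMul W p K₀ e) 1 z) = 0 := by
    rw [Levels.localization_map_one, hb]
    exact map_zero _
  rw [hz] at hloc
  have hres := res_connectingClass (hrange := Levels.exists_primaryInclusion_eq_of_nsmul_eq_zero W p K₀)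
    (v.adicCompletion K) (Levels.primaryInclusion_injective W p K₀)
    (hrangeE := Levels.exists_primaryInclusion_restrictField_eq_of_nsmul_eq_zero W p K₀ (v.adicCompletion K))
    (Levels.primaryInclusion_restrictField_injective W p K₀ (v.adicCompletion K)) Q hQ
  have hloc' : Levels.connectingClass ((Levels.primaryInclusion W p K₀).restrictField (v.adicCompletion K)) (p ^ K₀)
      (Levels.exists_primaryInclusion_restrictField_eq_of_nsmul_eq_zero W p K₀ (v.adicCompletion K))
      (Levels.primaryInclusion_restrictField_injective W p K₀ (v.adicCompletion K)) Q (fun σ ↦ hQ (absGaloisRestrict K _ σ)) = 0 := by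
    rw [← hres]
    exact hloc
  -- the local connecting class vanishes: `p^{K₀} Q = p^{K₀} Q₀`, `Q₀` locally fixed, hence `0`
  obtain ⟨Q₀, hQ₀, hQQ⟩ := (Levels.connectingClass_eq_zero_iff (Levels.primaryInclusion_restrictField_injective W p K₀ (v.adicCompletion K))
    (Levels.pow_nsmul_geomTorsion_eq_zero W p K₀) Q _).mp hloc'
  have hQ0 : p ^ K₀ • Q = 0 := by rw [← hQQ]; exact hc Q₀ hQ₀
  exact (Levels.connectingClass_eq_zero_iff (Levels.primaryInclusion_injective W p K₀) (Levels.pow_nsmul_geomTorsion_eq_zero W p K₀) Q hQ).mpr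
    ⟨0, fun σ ↦ map_zero _, by rw [smul_zero, hQ0]⟩

end Kernel

end Summit.BirchSwinnertonDyer.BirchSwinnertonDyer.Theorems.PrintCf2.LevelEigen

end
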